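import Literature.AlgebraicGeometry.HodgeTheory.GluedBlocksDivisorClasses
import Literature.AlgebraicGeometry.HodgeTheory.HodgeRiemannPolarizabilityProofs
import Literature.AlgebraicGeometry.HodgeTheory.HodgeFiltrationModelsReductionProofs
import Literature.AlgebraicGeometry.HodgeTheory.ComplexConjugationHolds
import Literature.AlgebraicGeometry.Motives.HodgeStructureDirectSum
import HarnessLib

/-!
# An abelian variety with an endomorphism of finite order has an INVARIANT polarization form (averaging)

Companion of the Summits-side Weil-type ladder files `Theorems/WeilTypeLadderTwistDecomposable{,Instances}` (b2b cell `hweil`),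
whose polarization binder `ψ` (non-degenerate, `s`-invariant, isotropic on `H^{1,0}` and `H^{0,1}`) is DISCHARGED here:

* `exists_invariant_polarizationForm` — for a complex abelian variety `B` and `s : B ⟶ B` with `s^m = 𝟙` (`m ≥ 1`) there is a
  `ℚ`-bilinear form `ψ` on `H¹(B(ℂ); ℚ)` which is non-degenerate, `s^*`-invariant, and whose complexification kills pairs of
  preimages of `H^{1,0}` and pairs of preimages of `H^{0,1}`. PROOF: `H¹(B(ℂ); ℚ)` carries a polarizable `ℚ`-Hodge structure of weight
  one (the tree THEOREMS `BettiUniverse.hodge`, `smoothProjective_hodgeStructure_isPolarizable_holds`, with the framework theorems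
  `exists_isReal_hodgeModel_holds`, `hodgePQ_independent_of_hodgeModel_holds`); a polarization `Q` is AVERAGED over the cyclic
  group `⟨s^*⟩`: `ψ(x, y) = Σ_{k<m} Q((s^*)^k x, (s^*)^k y)` is again a polarization (`averagedPolarization`: pull-backs are
  morphisms of Hodge structures, `BettiUniverse.pullHodgeHom`, so each summand satisfies both Riemann relations, and positivity
  adds up), hence non-degenerate (`Polarization.nondegenerate`), visibly `s^*`-invariant, and isotropic on `H^{1,0}`, `H^{0,1}`
  (first Riemann relation, `form_baseChange_eq_zero_of_mem_piece_one_zero/zero_one` + `BettiUniverse.mem_hodge_piece_iff`).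

No `def` is introduced except inside proofs (`averagedPolarization` is a theorem-level `Nonempty` statement); no named fact; no
`sorry`; imports `Literature.*` + `HarnessLib` only. HONEST LABEL: standard Hodge theory; nothing here is a rung; Markman-free.
[cite: VoisinHodgeI2002, §7.1.2 (Def. 7.7) and §7.3.2] [cite: DeligneHodgeII1971, 2.1.15] [cite: LangeBirkenhake1992, §5.1 and Cor. 5.3.4]

Provenance: Literature home (family `hodge`) of the Summits-side `Theorems/WeilTypeLadderTwistInvariantPolarization` (cell `pub-hodgecm2` ∕ `pub-hodge-ring2`; all its imports are `Literature/` and Mathlib), which `Literature/` may not import; theorems only, no named fact, no definition. Nothing here bears on `HC_CM`; no case of the Hodge conjecture beyond the stated unconditional ones is claimed. Lane `lit-hodgefound` (Layer A2/A3: polarizations, CM types, reflex fields, Hodge and Mumford–Tate groups), seat p20.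
-/

noncomputable section

open _root_.CategoryTheory
open scoped TensorProduct
open Literature.AlgebraicGeometry Literature.AlgebraicGeometry.Motives
open Literature.AlgebraicGeometry.Motives.HodgeStructure
open Literature.AlgebraicGeometry.HodgeTheory
open Literature.AlgebraicTopology.SingularHomology

namespace Literature.AlgebraicGeometry.HodgeTheory.InvariantPolarization

/-! ### §1 Base change of a finite sum of bilinear forms -/

section Sums

variable {V : Type*} [AddCommGroup V] [Module ℚ V] {ι : Type*}

/-- Base change is additive in the bilinear form (pointwise). [cite: LangeBirkenhake1992, §5.1] -/
theorem baseChange_add_apply (B₁ B₂ : LinearMap.BilinForm ℚ V) (x y : ℂ ⊗[ℚ] V) :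
    LinearMap.BilinForm.baseChange ℂ (B₁ + B₂) x y =
      LinearMap.BilinForm.baseChange ℂ B₁ x y + LinearMap.BilinForm.baseChange ℂ B₂ x y := by
  induction x using TensorProduct.induction_on generalizing y with
  | zero => simp
  | tmul c v =>
    induction y using TensorProduct.induction_on with
    | zero => simp
    | tmul d w => simp only [LinearMap.BilinForm.baseChange_tmul, LinearMap.add_apply, add_smul]
    | add y₁ y₂ h₁ h₂ => rw [map_add, map_add, map_add, h₁, h₂]; abel
  | add x₁ x₂ h₁ h₂ =>
    rw [map_add, LinearMap.add_apply, map_add, LinearMap.add_apply, map_add, LinearMap.add_apply, h₁, h₂]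
    abel

/-- Base change commutes with finite sums of bilinear forms (pointwise). [cite: LangeBirkenhake1992, §5.1] -/
theorem baseChange_finset_sum_apply (s : Finset ι) (B : ι → LinearMap.BilinForm ℚ V) (x y : ℂ ⊗[ℚ] V) :
    LinearMap.BilinForm.baseChange ℂ (∑ k ∈ s, B k) x y = ∑ k ∈ s, LinearMap.BilinForm.baseChange ℂ (B k) x y := by
  classical
  induction s using Finset.induction_on with
  | empty => simp only [Finset.sum_empty, LinearMap.BilinForm.baseChange_zero, LinearMap.zero_apply]
  | insert a s ha ih => rw [Finset.sum_insert ha, Finset.sum_insert ha, baseChange_add_apply, ih]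

end Sums

/-! ### §2 Averaging a polarization over a finite cyclic group of Hodge automorphisms -/

section Averaging

variable {V : Type*} [AddCommGroup V] [Module ℚ V] {n : ℤ}

/-- **The averaged polarization.** `H` a `ℚ`-Hodge structure, `Q` a polarization, `S : V →ₗ[ℚ] V` with `S^m = 1` (`m ≥ 1`)
such that every power `S^k` underlies a morphism of Hodge structures `H → H`: then `Σ_{k<m} Q(S^k x, S^k y)` is a polarization
of `H` (both Riemann relations summand by summand; positivity adds over a non-empty range). [cite: VoisinHodgeI2002, §7.1.2 Def. 7.7]
[cite: DeligneHodgeII1971, 2.1.15] -/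
theorem nonempty_averagedPolarization (H : HodgeStructure V n) (Q : H.Polarization) (S : V →ₗ[ℚ] V) {m : ℕ} (hm : 0 < m)
    (hSm : S ^ m = 1) (hS : ∀ k : ℕ, ∃ f : HodgeStructure.Hom H H, f.toLinearMap = S ^ k) :
    ∃ P : H.Polarization, P.form = ∑ k ∈ Finset.range m, Q.form.compl₁₂ (S ^ k) (S ^ k) := by
  classical
  have hinj : ∀ k : ℕ, Function.Injective ((S ^ k).baseChange ℂ) := by
    intro k x y hxy
    have h := congrArg ((S ^ (m * (k + 1) - k)).baseChange ℂ) hxy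
    have hpow : (S ^ (m * (k + 1) - k)) * S ^ k = 1 := by
      rw [← pow_add, Nat.sub_add_cancel (by nlinarith), pow_mul, hSm, one_pow]
    have hcomp : ∀ z, (S ^ (m * (k + 1) - k)).baseChange ℂ ((S ^ k).baseChange ℂ z) = z := by
      intro z
      rw [← LinearMap.comp_apply, ← LinearMap.baseChange_comp, ← Module.End.mul_eq_comp, hpow]
      change (LinearMap.id : V →ₗ[ℚ] V).baseChange ℂ z = z
      rw [LinearMap.baseChange_id, LinearMap.id_apply]
    rwa [hcomp, hcomp] at h
  refine ⟨{ form := ∑ k ∈ Finset.range m, Q.form.compl₁₂ (S ^ k) (S ^ k)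
            flip_form := ?_
            form_apply_eq_zero := ?_
            pos := ?_ }, rfl⟩
  · refine LinearMap.ext fun x => LinearMap.ext fun y => ?_
    rw [LinearMap.BilinForm.flip_apply]
    simp only [LinearMap.sum_apply, LinearMap.smul_apply, LinearMap.compl₁₂_apply, Finset.smul_sum]
    refine Finset.sum_congr rfl fun k _ => ?_
    have h := LinearMap.congr_fun₂ Q.flip_form ((S ^ k) x) ((S ^ k) y)
    simp only [LinearMap.BilinForm.flip_apply, LinearMap.smul_apply] at h
    exact h
  · intro p x hx y hy
    rw [baseChange_finset_sum_apply]
    refine Finset.sum_eq_zero fun k _ => ?_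
    obtain ⟨f, hf⟩ := hS k
    rw [HodgeStructure.baseChange_compl₁₂, ← hf]
    exact Q.form_apply_eq_zero p _ (f.map_F_le p ⟨x, hx, rfl⟩) _ (f.map_F_le _ ⟨y, hy, rfl⟩)
  · intro p q hpq x hx hx0
    -- each summand is a positive real
    have hterm : ∀ k ∈ Finset.range m, ∃ r : ℝ, 0 < r ∧
        Complex.I ^ p * (Complex.I ^ q)⁻¹ *
          LinearMap.BilinForm.baseChange ℂ (Q.form.compl₁₂ (S ^ k) (S ^ k)) x (conj x) = r := by
      intro k _
      obtain ⟨f, hf⟩ := hS k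
      have hxk : (S ^ k).baseChange ℂ x ∈ H.piece p q := by
        rw [← hf]; exact f.map_piece_le p q ⟨x, hx, rfl⟩
      have hxk0 : (S ^ k).baseChange ℂ x ≠ 0 := fun h => hx0 (hinj k (by rw [h, map_zero]))
      obtain ⟨r, hr, hQ⟩ := Q.pos p q hpq _ hxk hxk0
      refine ⟨r, hr, ?_⟩
      rw [HodgeStructure.baseChange_compl₁₂, ← conj_baseChange]
      exact hQ
    choose! r hr hreq using hterm
    refine ⟨∑ k ∈ Finset.range m, r k, Finset.sum_pos (fun k hk => hr k hk) ⟨0, Finset.mem_range.2 hm⟩, ?_⟩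
    rw [baseChange_finset_sum_apply, Finset.mul_sum, Complex.ofReal_sum]
    exact Finset.sum_congr rfl fun k hk => hreq k hk

end Averaging

/-! ### §3 The invariant polarization form of an abelian variety with an endomorphism of finite order -/

section AbelianVariety

variable {B : AbelianVariety ℂ}

/-- Powers of the `ℚ`-pull-back along an endomorphism are pull-backs along its powers. [cite: HatcherAT2002, §3.1 p. 198] -/
theorem pull_pow_eq (s : B ⟶ B) (k : ℕ) :
    BettiUniverse.pull (CategoryTheory.End.asHom (CategoryTheory.End.of s ^ k)).hom.hom.hom 1 =
      BettiUniverse.pull s.hom.hom.hom 1 ^ k := by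
  induction k with
  | zero =>
    rw [pow_zero, pow_zero]
    exact BettiUniverse.pull_id B.X 1
  | succ k ih =>
    rw [pow_succ, pow_succ', CategoryTheory.End.mul_def, Module.End.mul_eq_comp, ← ih]
    exact BettiUniverse.pull_comp s.hom.hom.hom (CategoryTheory.End.asHom (CategoryTheory.End.of s ^ k)).hom.hom.hom 1

/-- **An abelian variety with an endomorphism `s` of finite order carries an `s`-invariant polarization form**: a
non-degenerate `ℚ`-bilinear form on `H¹(B(ℂ); ℚ)`, invariant under `s^*`, whose complexification is isotropic on `H^{1,0}` and on
`H^{0,1}` (average any polarization of the weight-one Hodge structure over `⟨s^*⟩`). This discharges the binder `ψ` of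
`weilClassesField_le_divisorClassesSpan_of_twist`. [cite: VoisinHodgeI2002, §7.1.2 and §7.3.2] [cite: LangeBirkenhake1992, Cor. 5.3.4] -/
theorem exists_invariant_polarizationForm (B : AbelianVariety ℂ) (s : B ⟶ B) {m : ℕ} (hm : 0 < m)
    (hsm : CategoryTheory.End.of s ^ m = 1) :
    ∃ ψ : LinearMap.BilinForm ℚ (bettiCohomology B.X 1), ψ.Nondegenerate ∧
      (∀ x y : bettiCohomology B.X 1,
        ψ ((bettiCohomology.map s.hom.hom.hom 1).hom x) ((bettiCohomology.map s.hom.hom.hom 1).hom y) = ψ x y) ∧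
      (∀ x y : ℂ ⊗[ℚ] bettiCohomology B.X 1,
        ofRatClassBaseChange (Motives.ComplexPoints B.X) 1 x ∈
            hodgeOneZero (AbelianVariety.isSmoothProjective_holds (A := B)) →
          ofRatClassBaseChange (Motives.ComplexPoints B.X) 1 y ∈
            hodgeOneZero (AbelianVariety.isSmoothProjective_holds (A := B)) → ψ.baseChange ℂ x y = 0) ∧
      (∀ x y : ℂ ⊗[ℚ] bettiCohomology B.X 1,
        ofRatClassBaseChange (Motives.ComplexPoints B.X) 1 x ∈
            hodgeZeroOne (AbelianVariety.isSmoothProjective_holds (A := B)) →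
          ofRatClassBaseChange (Motives.ComplexPoints B.X) 1 y ∈
            hodgeZeroOne (AbelianVariety.isSmoothProjective_holds (A := B)) → ψ.baseChange ℂ x y = 0) := by
  classical
  have hX : IsSmoothProjective B.dim B.X := AbelianVariety.isSmoothProjective_holds (A := B)
  have hHD : exists_isReal_hodgeModel := exists_isReal_hodgeModel_holds
  have hI : hodgePQ_independent_of_hodgeModel := hodgePQ_independent_of_hodgeModel_holds
  obtain ⟨Q⟩ : (BettiUniverse.hodge hHD hX 1).IsPolarizable :=
    smoothProjective_hodgeStructure_isPolarizable_holds hX (BettiUniverse.realHodgeModel hHD hX)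
      (BettiUniverse.realHodgeModel_isHodgeSymmetric hHD hX) 1
  set S : bettiCohomology B.X 1 →ₗ[ℚ] bettiCohomology B.X 1 := BettiUniverse.pull s.hom.hom.hom 1 with hSdef
  have hSk : ∀ k : ℕ, BettiUniverse.pull (CategoryTheory.End.asHom (CategoryTheory.End.of s ^ k)).hom.hom.hom 1 = S ^ k :=
    fun k => pull_pow_eq s k
  have hSm : S ^ m = 1 := by
    rw [← hSk m, hsm]
    exact BettiUniverse.pull_id B.X 1
  have hS : ∀ k : ℕ, ∃ f : HodgeStructure.Hom (BettiUniverse.hodge hHD hX 1) (BettiUniverse.hodge hHD hX 1),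
      f.toLinearMap = S ^ k := fun k =>
    ⟨BettiUniverse.pullHodgeHom hHD hI hX hX (CategoryTheory.End.asHom (CategoryTheory.End.of s ^ k)).hom.hom.hom 1, by
      rw [BettiUniverse.pullHodgeHom_toLinearMap, hSk]⟩
  obtain ⟨P, hP⟩ := nonempty_averagedPolarization _ Q S hm hSm hS
  refine ⟨P.form, P.nondegenerate, ?_, ?_, ?_⟩
  · intro x y
    change P.form (S x) (S y) = P.form x y
    rw [hP, LinearMap.sum_apply, LinearMap.sum_apply, LinearMap.sum_apply, LinearMap.sum_apply]
    simp only [LinearMap.compl₁₂_apply]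
    have hshift : ∀ k, (S ^ k) (S x) = (S ^ (k + 1)) x := fun k => by rw [pow_succ, Module.End.mul_apply]
    have hshift' : ∀ k, (S ^ k) (S y) = (S ^ (k + 1)) y := fun k => by rw [pow_succ, Module.End.mul_apply]
    simp only [hshift, hshift']
    obtain ⟨m', rfl⟩ : ∃ m', m = m' + 1 := ⟨m - 1, by omega⟩
    rw [Finset.sum_range_succ' (fun k => Q.form ((S ^ k) x) ((S ^ k) y)), Finset.sum_range_succ, hSm, pow_zero]
  · intro x y hx hy
    exact form_baseChange_eq_zero_of_mem_piece_one_zero hHD P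
      ((BettiUniverse.mem_hodge_piece_iff hHD hI hX (k := 1) (p := 1) (q := 0) rfl x).2 hx)
      ((BettiUniverse.mem_hodge_piece_iff hHD hI hX (k := 1) (p := 1) (q := 0) rfl y).2 hy)
  · intro x y hx hy
    exact form_baseChange_eq_zero_of_mem_piece_zero_one hHD P
      ((BettiUniverse.mem_hodge_piece_iff hHD hI hX (k := 1) (p := 0) (q := 1) rfl x).2 hx)
      ((BettiUniverse.mem_hodge_piece_iff hHD hI hX (k := 1) (p := 0) (q := 1) rfl y).2 hy)

end AbelianVariety

end Literature.AlgebraicGeometry.HodgeTheory.InvariantPolarization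

end
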